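import Literature.AnabelianGeometry.SemiGraphs.PSCSeparatingCoveringsUnrOfVertexQuotients
import HarnessLib

/-!
# [CombGC] Prop. 1.2 (i)/(ii), unramified verticial subgroups, from [IUTchI] Rmk. 1.2.3 (iv) — the consumers of row F-2828 re-derived

Mochizuki, *A combinatorial version of the Grothendieck conjecture*, Tohoku Math. J. **59** (2007)
[CombGC], Proposition 1.2, author's manuscript p. 8: "(i) … if `B₁ ∩ B₂` is open in `B₁`, then
`v₁ = v₂`. (ii) … the `Bᵢ` are commensurably terminal in `Π^unr_G`" (the `Bᵢ` the images in `Π^unr_G`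
of verticial subgroups, `G` sturdy), proved on p. 9 from separating `Π^unr_G`-coverings
[cite: MochizukiCombGC2007, Prop 1.2 pp.8-9].

PROOF-ONLY sequel (400-line rule) of `PSCSeparatingCoveringsUnrOfVertexQuotients.lean` (abc-iut cell,
FACT-LIST row F-2828 `PSCDatum.UnrVerticialSeparatingCoverings`).  That file derives F-2828 RESTRICTED
TO THE `Π^unr`-LEVELS `V ⊇ Ker(Π_G ↠ Π^unr_G)` from the vertex quotients of [IUTchI] Rmk. 1.2.3 (iv) at
covering data.  Every tree consumer of F-2828 — abc-iut-w5-d183's `sameVertex_of_isOpen_unr` →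
`commensurator_unrVertGp_eq_of_separating` → `unrVerticialCommensurablyTerminal_of_separating` (row
P12-L03-U) and `unrVerticialOpenInterDeterminesVertex_of_separating` (row P12-L02-U) — instantiates the
row ONLY at levels `U ∩ U₁ ⊇ Ker`.  Here those proofs are rerun VERBATIM with the hypothesis weakened
to the `Π^unr`-levels (§5), and composed with the origin-level derivation (§6):

* `unrVerticialOpenInterDeterminesVertex_of_origin_frozen`,
  `unrVerticialCommensurablyTerminal_of_origin_frozen`, `prop12_unr_of_origin'` — **[CombGC] Prop. 1.2
  (i) and (ii) for the unramified verticial subgroups of every `Ω`-datum, from the named inputs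
  `RestrictBDOfPSCTypeHolds Ω`, [IUTchI] Rmk. 1.2.3 (iv) (frozen F-1938 `UnrVerticialCharacterizationHolds Ω`
  or its successor `UnrVerticialCharacterizationHolds' Ω`), Rmk. 1.1.5 (`UnrVertAbOfRankHolds Ω`) and
  profiniteness — WITHOUT any separating-coverings assumption.**

* `prop12_verticial_unr_of_origin_frozen` (§7) — the summary for certificate writers: Prop. 1.2 (i)
  and (ii) for the verticial subgroups (abc-iut-f-165's `verticialSeparatingCoverings_of_origin_frozen`,
  which needs `SturdyCoverHolds Ω` in addition, composed with abc-iut-w5-d183's P12-L02-V / P12-L03-V)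
  AND for the unramified verticial subgroups, from the five named inputs, no separating assumption.

So of the origin-level input P12-L01 only the EDGE-LIKE third (row F-2827) remains an independent
assumption of the node `CombGC:Prop1.2` (abc-iut-f-165's census: it needs the structure of `M^edge`,
[CombGC] Prop. 1.3, which the tree does not type).
0 definitions; typed ≠ proved for the inputs; a FACT row is an assumption label; nothing here takes a
side on [IUTchIII] Cor. 3.12.
-/

noncomputable section

namespace Literature.AnabelianGeometry.SemiGraphs

namespace PSCDatum

open scoped Pointwise

universe u

variable {P : Type u} [Group P] [TopologicalSpace P] [IsTopologicalGroup P]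

/-! ### 5. The consumers of F-2828, re-derived from the restricted form

abc-iut-w5-d183's `sameVertex_of_isOpen_unr` (Prop. 1.2 (i) at a `Π^unr`-level) and
`commensurator_unrVertGp_eq_of_separating` (Prop. 1.2 (ii), unramified) call
`UnrVerticialSeparatingCoverings` only at levels `U ∩ U₁ ⊇ Ker`; the proofs below are theirs verbatim
with the hypothesis weakened to the `Π^unr`-levels. -/

section Consumers

variable [CompactSpace P] [TotallyDisconnectedSpace P] (G : PSCDatum P)

omit [TopologicalSpace P] [IsTopologicalGroup P] [CompactSpace P] [TotallyDisconnectedSpace P] in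
/-- Membership in a double coset `U γ₀ A`, solved for the left factor (private copy of the lemma of
`PSCSeparatingCoveringsProofs2.lean`). [folklore] -/
private theorem mem_mul_conj_of_mul_mem_doubleCoset' {U A : Subgroup P} {g γ₀ : P}
    (h : g * γ₀ ∈ DoubleCoset.doubleCoset γ₀ (U : Set P) (A : Set P)) :
    g ∈ (U : Set P) * ((ConjAct.toConjAct γ₀ • A : Subgroup P) : Set P) := by
  obtain ⟨u, hu, a, ha, heq⟩ := DoubleCoset.mem_doubleCoset.mp h
  refine Set.mem_mul.mpr ⟨u, hu, γ₀ * a * γ₀⁻¹, ?_, ?_⟩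
  · rw [SetLike.mem_coe, Subgroup.mem_pointwise_smul_iff_inv_smul_mem]
    simpa [ConjAct.smul_def, mul_assoc] using ha
  · calc u * (γ₀ * a * γ₀⁻¹) = (u * γ₀ * a) * γ₀⁻¹ := by group
      _ = g * γ₀ * γ₀⁻¹ := by rw [← heq]
      _ = g := by group

omit [TopologicalSpace P] [IsTopologicalGroup P] [CompactSpace P] [TotallyDisconnectedSpace P] in
/-- The carrier of `(A₁ ⊓ A₂).subgroupOf A₁` is the preimage of `A₂` in `A₁` (private copy of the
lemma of `PSCSeparatingCoveringsProofs.lean`). [folklore] -/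
private theorem coe_inf_subgroupOf' (A₁ A₂ : Subgroup P) :
    (((A₁ ⊓ A₂).subgroupOf A₁ : Subgroup A₁) : Set A₁) = ((↑) : A₁ → P) ⁻¹' (A₂ : Set P) := by
  ext x
  simp only [SetLike.mem_coe, Subgroup.mem_subgroupOf, Subgroup.mem_inf, Set.mem_preimage,
    and_iff_right x.2]

omit [IsTopologicalGroup P] [CompactSpace P] [TotallyDisconnectedSpace P] in
/-- Transport of relative openness along an equality of the ambient subgroup (private copy).
[folklore] -/
private theorem isOpen_preimage_of_eq' {A B : Subgroup P} (hAB : A = B) {S : Set P}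
    (h : IsOpen (((↑) : A → P) ⁻¹' S)) : IsOpen (((↑) : B → P) ⁻¹' S) := by
  subst hAB
  exact h

/-- **Prop. 1.2 (i) at the `Π^unr_G`-level `U ⊇ Ker`** (abc-iut-w5-d183's `sameVertex_of_isOpen_unr`)
from F-2828 RESTRICTED TO THE `Π^unr`-LEVELS: if the unramified decomposition groups
`U ∩ (γᵢΠ_{vᵢ}γᵢ⁻¹·Ker)` meet in a relatively open subgroup of the first, the two vertices of `G_U`
coincide.  The separating level used is `U ∩ U₁ ⊇ Ker`. [cite: MochizukiCombGC2007, Prop 1.2(i) p.9] -/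
theorem sameVertex_of_isOpen_unr_of_unrLevels
    (hsepK : G.IsSturdy → ∀ V : Subgroup P, V.Normal → IsOpen (V : Set P) → G.unrKer ≤ V →
      ∃ V' : Subgroup P, V'.Normal ∧ IsOpen (V' : Set P) ∧ V' ≤ V ∧
        ∀ (v₁ v₂ : G.graph.V) (γ₁ γ₂ : ConjAct P),
          (v₁ ≠ v₂ ∨
            DoubleCoset.doubleCoset (ConjAct.ofConjAct γ₁) (V' : Set P)
                ((G.vertGp v₁ ⊔ G.unrKer : Subgroup P) : Set P) ≠
              DoubleCoset.doubleCoset (ConjAct.ofConjAct γ₂) (V' : Set P)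
                ((G.vertGp v₂ ⊔ G.unrKer : Subgroup P) : Set P)) →
          ∃ U : Subgroup P, IsOpen (U : Set P) ∧ U ≤ V' ∧ (U.subgroupOf V').Normal ∧
            (γ₂ • G.vertGp v₂ ⊔ G.unrKer) ⊓ V' ≤ U ∧ ¬ ((γ₁ • G.vertGp v₁) ⊓ V' ≤ U))
    (hst : G.IsSturdy) (U : Subgroup P) (hUo : IsOpen (U : Set P)) [hUn : U.Normal]
    (hKU : G.unrKer ≤ U) (v₁ v₂ : G.graph.V) (γ₁ γ₂ : ConjAct P)
    (h : IsOpen (((↑) : ↥(U ⊓ (γ₁ • G.vertGp v₁ ⊔ G.unrKer)) → P) ⁻¹'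
      ((γ₂ • G.vertGp v₂ ⊔ G.unrKer : Subgroup P) : Set P))) :
    v₁ = v₂ ∧ ConjAct.ofConjAct γ₂ ∈
      DoubleCoset.doubleCoset (ConjAct.ofConjAct γ₁) (U : Set P) (G.vertGp v₁ : Set P) := by
  by_contra hne
  obtain ⟨U₁, hU₁o, hU₁n, hKU₁, hU₁⟩ :=
    exists_openNormal_inf_le (K := G.unrKer) (A₂ := γ₂ • G.vertGp v₂ ⊔ G.unrKer)
      (le_inf hKU le_sup_right) le_sup_right h
  obtain ⟨V', hV'n, hV'o, hV'le, hsepV⟩ :=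
    hsepK hst (U ⊓ U₁) inferInstance (hUo.inter hU₁o) (le_inf hKU hKU₁)
  have hV'U : V' ≤ U := hV'le.trans inf_le_left
  have hdist : v₁ ≠ v₂ ∨
      DoubleCoset.doubleCoset (ConjAct.ofConjAct γ₁) (V' : Set P)
          ((G.vertGp v₁ ⊔ G.unrKer : Subgroup P) : Set P) ≠
        DoubleCoset.doubleCoset (ConjAct.ofConjAct γ₂) (V' : Set P)
          ((G.vertGp v₂ ⊔ G.unrKer : Subgroup P) : Set P) := by
    by_contra hcon
    push Not at hcon
    obtain ⟨rfl, hdc⟩ := hcon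
    -- `γ₂ ∈ V' γ₁ (Π_{v₁}·Ker) = (V'·Ker) γ₁ Π_{v₁} ⊆ U γ₁ Π_{v₁}`
    have hmem : ConjAct.ofConjAct γ₂ ∈ DoubleCoset.doubleCoset (ConjAct.ofConjAct γ₁) (V' : Set P)
        ((G.vertGp v₁ ⊔ G.unrKer : Subgroup P) : Set P) := by
      rw [hdc]
      exact DoubleCoset.mem_doubleCoset_self V' (G.vertGp v₁ ⊔ G.unrKer) _
    refine hne ⟨rfl, ?_⟩
    obtain ⟨u, hu, b, hb, heq⟩ := DoubleCoset.mem_doubleCoset.mp hmem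
    have hb' : b ∈ ((G.vertGp v₁ ⊔ G.unrKer : Subgroup P) : Set P) := hb
    rw [Subgroup.mul_normal] at hb'
    obtain ⟨a, ha, k, hk, rfl⟩ := Set.mem_mul.mp hb'
    -- `γ₂ = u γ₁ a k = (u · (γ₁ a) k (γ₁ a)⁻¹) · γ₁ · a` with the conjugate of `k` in `Ker ≤ U`
    refine DoubleCoset.mem_doubleCoset.mpr
      ⟨u * ((ConjAct.ofConjAct γ₁ * a) * k * (ConjAct.ofConjAct γ₁ * a)⁻¹), ?_, a, ha, ?_⟩
    · refine U.mul_mem (hV'U hu) (hKU ?_)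
      exact (inferInstance : G.unrKer.Normal).conj_mem k hk _
    · rw [heq]
      group
  obtain ⟨U', -, -, -, htriv, hnon⟩ := hsepV v₁ v₂ γ₁ γ₂ hdist
  apply hnon
  intro x hx
  obtain ⟨hxA, hxV'⟩ := Subgroup.mem_inf.mp hx
  have hxU : x ∈ U := hV'U hxV'
  have hxU₁ : x ∈ U₁ := (inf_le_right : U ⊓ U₁ ≤ U₁) (hV'le hxV')
  have hx₁ : x ∈ U ⊓ (γ₁ • G.vertGp v₁ ⊔ G.unrKer) :=
    Subgroup.mem_inf.mpr ⟨hxU, (le_sup_left : γ₁ • G.vertGp v₁ ≤ _) hxA⟩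
  have hx₂ : x ∈ γ₂ • G.vertGp v₂ ⊔ G.unrKer := hU₁ (Subgroup.mem_inf.mpr ⟨hxU₁, hx₁⟩)
  exact htriv (Subgroup.mem_inf.mpr ⟨hx₂, hxV'⟩)

/-- **[CombGC] Prop. 1.2 (i), unramified verticial case (`G` sturdy)** (row P12-L02-U) from F-2828
restricted to the `Π^unr`-levels: "if `B₁ ∩ B₂` is open in `B₁`, then `v₁ = v₂`".
[cite: MochizukiCombGC2007, Prop 1.2(i) p.8] -/
theorem unrVerticialOpenInterDeterminesVertex_of_unrLevels
    (hsepK : G.IsSturdy → ∀ V : Subgroup P, V.Normal → IsOpen (V : Set P) → G.unrKer ≤ V →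
      ∃ V' : Subgroup P, V'.Normal ∧ IsOpen (V' : Set P) ∧ V' ≤ V ∧
        ∀ (v₁ v₂ : G.graph.V) (γ₁ γ₂ : ConjAct P),
          (v₁ ≠ v₂ ∨
            DoubleCoset.doubleCoset (ConjAct.ofConjAct γ₁) (V' : Set P)
                ((G.vertGp v₁ ⊔ G.unrKer : Subgroup P) : Set P) ≠
              DoubleCoset.doubleCoset (ConjAct.ofConjAct γ₂) (V' : Set P)
                ((G.vertGp v₂ ⊔ G.unrKer : Subgroup P) : Set P)) →
          ∃ U : Subgroup P, IsOpen (U : Set P) ∧ U ≤ V' ∧ (U.subgroupOf V').Normal ∧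
            (γ₂ • G.vertGp v₂ ⊔ G.unrKer) ⊓ V' ≤ U ∧ ¬ ((γ₁ • G.vertGp v₁) ⊓ V' ≤ U)) :
    G.UnrVerticialOpenInterDeterminesVertex := by
  intro hst v₁ v₂ γ₁ γ₂ h
  rw [coe_inf_subgroupOf'] at h
  have htop : IsOpen ((⊤ : Subgroup P) : Set P) := by simp
  exact (G.sameVertex_of_isOpen_unr_of_unrLevels hsepK hst ⊤ htop le_top v₁ v₂ γ₁ γ₂
    (isOpen_preimage_of_eq' (top_inf_eq _).symm h)).1

/-- **Prop. 1.2 (ii) for the unramified verticial subgroup `γΠ_vγ⁻¹·Ker`** (abc-iut-w5-d183's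
`commensurator_unrVertGp_eq_of_separating`) from F-2828 restricted to the `Π^unr`-levels: the
level-wise argument runs over the levels `U ⊇ Ker` only. [cite: MochizukiCombGC2007, Prop 1.2(ii) p.9] -/
theorem commensurator_unrVertGp_eq_of_unrLevels
    (hsepK : G.IsSturdy → ∀ V : Subgroup P, V.Normal → IsOpen (V : Set P) → G.unrKer ≤ V →
      ∃ V' : Subgroup P, V'.Normal ∧ IsOpen (V' : Set P) ∧ V' ≤ V ∧
        ∀ (v₁ v₂ : G.graph.V) (γ₁ γ₂ : ConjAct P),
          (v₁ ≠ v₂ ∨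
            DoubleCoset.doubleCoset (ConjAct.ofConjAct γ₁) (V' : Set P)
                ((G.vertGp v₁ ⊔ G.unrKer : Subgroup P) : Set P) ≠
              DoubleCoset.doubleCoset (ConjAct.ofConjAct γ₂) (V' : Set P)
                ((G.vertGp v₂ ⊔ G.unrKer : Subgroup P) : Set P)) →
          ∃ U : Subgroup P, IsOpen (U : Set P) ∧ U ≤ V' ∧ (U.subgroupOf V').Normal ∧
            (γ₂ • G.vertGp v₂ ⊔ G.unrKer) ⊓ V' ≤ U ∧ ¬ ((γ₁ • G.vertGp v₁) ⊓ V' ≤ U))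
    (hst : G.IsSturdy) (v : G.graph.V) (γ : ConjAct P) :
    Subgroup.Commensurable.commensurator (γ • G.vertGp v ⊔ G.unrKer) = γ • G.vertGp v ⊔ G.unrKer := by
  have hAc : IsClosed ((γ • G.vertGp v : Subgroup P) : Set P) :=
    isClosed_conj_smul (G.isClosed_vertGp v) γ
  have hBc : IsClosed ((γ • G.vertGp v ⊔ G.unrKer : Subgroup P) : Set P) := by
    rw [Subgroup.mul_normal]
    exact (G.isClosed_unrKer).mul_left_of_isCompact hAc.isCompact
  refine commensurator_eq_of_levelwise (K := G.unrKer) hBc le_sup_right fun U hUo hUn hKU g hrel => ?_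
  haveI := hUn
  have hK : (ConjAct.toConjAct g • G.unrKer : Subgroup P) = G.unrKer :=
    (inferInstance : G.unrKer.Normal).conjAct _
  have hrel' : IsOpen (((↑) : ↥(U ⊓ (γ • G.vertGp v ⊔ G.unrKer)) → P) ⁻¹'
      (((ConjAct.toConjAct g * γ) • G.vertGp v ⊔ G.unrKer : Subgroup P) : Set P)) := by
    rw [mul_smul, ← hK, ← Subgroup.smul_sup, hK]
    exact hrel
  obtain ⟨-, hmem⟩ :=
    G.sameVertex_of_isOpen_unr_of_unrLevels hsepK hst U hUo hKU v v γ (ConjAct.toConjAct g * γ) hrel'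
  have hmem' : g * ConjAct.ofConjAct γ ∈
      DoubleCoset.doubleCoset (ConjAct.ofConjAct γ) (U : Set P) (G.vertGp v : Set P) := by
    simpa using hmem
  have hg : g ∈ (U : Set P) * ((γ • G.vertGp v : Subgroup P) : Set P) := by
    simpa using mem_mul_conj_of_mul_mem_doubleCoset' hmem'
  exact Set.mul_subset_mul_left (SetLike.coe_subset_coe.mpr le_sup_left) hg

/-- **[CombGC] Prop. 1.2 (ii), unramified verticial subgroups (`G` sturdy)** (row P12-L03-U) from
F-2828 restricted to the `Π^unr`-levels: "the `Bᵢ` are commensurably terminal in `Π^unr_G`".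
[cite: MochizukiCombGC2007, Prop 1.2(ii) p.8] -/
theorem unrVerticialCommensurablyTerminal_of_unrLevels
    (hsepK : G.IsSturdy → ∀ V : Subgroup P, V.Normal → IsOpen (V : Set P) → G.unrKer ≤ V →
      ∃ V' : Subgroup P, V'.Normal ∧ IsOpen (V' : Set P) ∧ V' ≤ V ∧
        ∀ (v₁ v₂ : G.graph.V) (γ₁ γ₂ : ConjAct P),
          (v₁ ≠ v₂ ∨
            DoubleCoset.doubleCoset (ConjAct.ofConjAct γ₁) (V' : Set P)
                ((G.vertGp v₁ ⊔ G.unrKer : Subgroup P) : Set P) ≠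
              DoubleCoset.doubleCoset (ConjAct.ofConjAct γ₂) (V' : Set P)
                ((G.vertGp v₂ ⊔ G.unrKer : Subgroup P) : Set P)) →
          ∃ U : Subgroup P, IsOpen (U : Set P) ∧ U ≤ V' ∧ (U.subgroupOf V').Normal ∧
            (γ₂ • G.vertGp v₂ ⊔ G.unrKer) ⊓ V' ≤ U ∧ ¬ ((γ₁ • G.vertGp v₁) ⊓ V' ≤ U)) :
    G.UnrVerticialCommensurablyTerminal := by
  intro hst B hB
  obtain ⟨A, ⟨v, γ, rfl⟩, rfl⟩ := hB
  exact G.commensurator_unrVertGp_eq_of_unrLevels hsepK hst v γ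

end Consumers

/-! ### 6. Rows P12-L02-U / P12-L03-U from the named origin-level inputs -/

section OriginConsumers

variable (Ω : PSCOrigin.{u})

/-- **[CombGC] Prop. 1.2 (i), unramified verticial case, for every `Ω`-datum, from the named inputs**
`RestrictBDOfPSCTypeHolds Ω`, the frozen F-1938 `UnrVerticialCharacterizationHolds Ω`,
`UnrVertAbOfRankHolds Ω` and profiniteness — no separating-coverings assumption.
[cite: MochizukiCombGC2007, Prop 1.2(i) p.8] -/
theorem unrVerticialOpenInterDeterminesVertex_of_origin_frozen (hres : RestrictBDOfPSCTypeHolds Ω)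
    (hunr : UnrVerticialCharacterizationHolds Ω) (hrank : UnrVertAbOfRankHolds Ω)
    (hprof : ∀ ⦃Q : Type u⦄ [Group Q] [TopologicalSpace Q] [IsTopologicalGroup Q] (G : PSCDatum Q),
      Ω.IsOfPSCType G → CompactSpace Q ∧ TotallyDisconnectedSpace Q)
    {Q : Type u} [Group Q] [TopologicalSpace Q] [IsTopologicalGroup Q] (G : PSCDatum Q)
    (hG : Ω.IsOfPSCType G) : G.UnrVerticialOpenInterDeterminesVertex := by
  obtain ⟨hc, htd⟩ := hprof G hG
  exact G.unrVerticialOpenInterDeterminesVertex_of_unrLevels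
    (unrVerticialSeparating_unrLevels_of_origin_frozen Ω hres hunr hrank hprof G hG)

/-- **[CombGC] Prop. 1.2 (ii), unramified verticial subgroups, for every `Ω`-datum, from the named
inputs** `RestrictBDOfPSCTypeHolds Ω`, the frozen F-1938 `UnrVerticialCharacterizationHolds Ω`,
`UnrVertAbOfRankHolds Ω` and profiniteness — no separating-coverings assumption.
[cite: MochizukiCombGC2007, Prop 1.2(ii) p.8] -/
theorem unrVerticialCommensurablyTerminal_of_origin_frozen (hres : RestrictBDOfPSCTypeHolds Ω)
    (hunr : UnrVerticialCharacterizationHolds Ω) (hrank : UnrVertAbOfRankHolds Ω)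
    (hprof : ∀ ⦃Q : Type u⦄ [Group Q] [TopologicalSpace Q] [IsTopologicalGroup Q] (G : PSCDatum Q),
      Ω.IsOfPSCType G → CompactSpace Q ∧ TotallyDisconnectedSpace Q)
    {Q : Type u} [Group Q] [TopologicalSpace Q] [IsTopologicalGroup Q] (G : PSCDatum Q)
    (hG : Ω.IsOfPSCType G) : G.UnrVerticialCommensurablyTerminal := by
  obtain ⟨hc, htd⟩ := hprof G hG
  exact G.unrVerticialCommensurablyTerminal_of_unrLevels
    (unrVerticialSeparating_unrLevels_of_origin_frozen Ω hres hunr hrank hprof G hG)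

/-- The same two conclusions from the SUCCESSOR statement `UnrVerticialCharacterizationHolds' Ω`
(p430737) in place of the frozen F-1938. [cite: MochizukiCombGC2007, Prop 1.2(ii) p.8] -/
theorem prop12_unr_of_origin' (hres : RestrictBDOfPSCTypeHolds Ω)
    (hunr : UnrVerticialCharacterizationHolds' Ω) (hrank : UnrVertAbOfRankHolds Ω)
    (hprof : ∀ ⦃Q : Type u⦄ [Group Q] [TopologicalSpace Q] [IsTopologicalGroup Q] (G : PSCDatum Q),
      Ω.IsOfPSCType G → CompactSpace Q ∧ TotallyDisconnectedSpace Q)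
    {Q : Type u} [Group Q] [TopologicalSpace Q] [IsTopologicalGroup Q] (G : PSCDatum Q)
    (hG : Ω.IsOfPSCType G) :
    G.UnrVerticialOpenInterDeterminesVertex ∧ G.UnrVerticialCommensurablyTerminal := by
  obtain ⟨hc, htd⟩ := hprof G hG
  have h := unrVerticialSeparating_unrLevels_of_origin' Ω hres hunr hrank hprof G hG
  exact ⟨G.unrVerticialOpenInterDeterminesVertex_of_unrLevels h,
    G.unrVerticialCommensurablyTerminal_of_unrLevels h⟩

end OriginConsumers

/-! ### 7. Summary for certificate writers: Prop. 1.2 (i)(ii) for verticial AND unramified verticial subgroups, no separating assumption -/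

section Summary

variable (Ω : PSCOrigin.{u})

/-- **[CombGC] Prop. 1.2 (i) and (ii) for the verticial subgroups `γΠ_vγ⁻¹` (in `Π_G`) AND the
unramified verticial subgroups `γΠ_vγ⁻¹·Ker` (in `Π^unr_G`, `G` sturdy) of every `Ω`-datum, from the
named origin statements ONLY** — `RestrictBDOfPSCTypeHolds Ω`, [CombGC] Rmk. 1.1.5 (`SturdyCoverHolds Ω`,
used for the verticial half only), [IUTchI] Rmk. 1.2.3 (iv) (frozen F-1938 `UnrVerticialCharacterizationHolds Ω`),
Rmk. 1.1.5's rank statement (`UnrVertAbOfRankHolds Ω`) and profiniteness: the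
verticial half through abc-iut-f-165's `verticialSeparatingCoverings_of_origin_frozen` and abc-iut-w5-d183's
P12-L02-V / P12-L03-V, the unramified half through §6.  After this, of the sub-DAG input P12-L01 only the
EDGE-LIKE third (row F-2827) remains an origin-level assumption of the node `CombGC:Prop1.2`.
[cite: MochizukiCombGC2007, Prop 1.2 pp.8-9] -/
theorem prop12_verticial_unr_of_origin_frozen (hres : RestrictBDOfPSCTypeHolds Ω)
    (hstc : SturdyCoverHolds Ω) (hunr : UnrVerticialCharacterizationHolds Ω)
    (hrank : UnrVertAbOfRankHolds Ω)
    (hprof : ∀ ⦃Q : Type u⦄ [Group Q] [TopologicalSpace Q] [IsTopologicalGroup Q] (G : PSCDatum Q),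
      Ω.IsOfPSCType G → CompactSpace Q ∧ TotallyDisconnectedSpace Q)
    {Q : Type u} [Group Q] [TopologicalSpace Q] [IsTopologicalGroup Q] (G : PSCDatum Q)
    (hG : Ω.IsOfPSCType G) :
    G.VerticialOpenInterDeterminesVertex ∧ G.UnrVerticialOpenInterDeterminesVertex ∧
      (∀ (v : G.graph.V) (γ : ConjAct Q),
        Subgroup.Commensurable.commensurator (γ • G.vertGp v) = γ • G.vertGp v) ∧
      G.UnrVerticialCommensurablyTerminal := by
  obtain ⟨hc, htd⟩ := hprof G hG
  have hV : G.VerticialSeparatingCoverings :=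
    verticialSeparatingCoverings_of_origin_frozen Ω hres hstc hunr hrank hprof G hG
  exact ⟨G.verticialOpenInterDeterminesVertex_of_separating hV,
    unrVerticialOpenInterDeterminesVertex_of_origin_frozen Ω hres hunr hrank hprof G hG,
    fun v γ => G.commensurator_vertGp_eq_of_separating hV v γ,
    unrVerticialCommensurablyTerminal_of_origin_frozen Ω hres hunr hrank hprof G hG⟩

end Summary

end PSCDatum

end Literature.AnabelianGeometry.SemiGraphs

end
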